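import Mathlib.RingTheory.RootsOfUnity.PrimitiveRoots
import Mathlib.RingTheory.Polynomial.Cyclotomic.Roots
import Mathlib.FieldTheory.IsAlgClosed.Basic
import Literature.AnabelianGeometry.EtaleTheta.ClassicalTheta
import Literature.AnabelianGeometry.EtaleTheta.ClassicalThetaSpecialFibre
import HarnessLib

/-!
# [ExpEst] §3: Lemma 3.1 (group actions on primitive roots of unity) and Proposition 3.2 (theta values at
# primitive 12-th roots of unity) — PROVED

S. Mochizuki, I. Fesenko, Y. Hoshi, A. Minamide, W. Porowski, *Explicit estimates in inter-universal
Teichmüller theory*, Kodai Math. J. **45** (2022) 175–236 (= [ExpEst]), §3 "μ₆-theory for [EtTh]",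
journal pp. 198–199 (render `plan/repair/lit/renders/MFHMP-ExplicitEstimates-Kodai2022-book-anonnd-eeiutp`,
pdf p. 24 l.17 – p. 25 l.31; pdf page = journal page − 174). These two items are the "fundamental observation
due to Porowski" (Rmk. 3.2.1; Introduction p. 181: "`n` satisfies the conditions (1), (2) if and only if
`n = 6`") on which the paper's modified normalisation of étale theta functions ("of μ₆-standard type",
Def. 3.3) rests. Both are elementary and UNDISPUTED; both are PROVED here, over the tree's classical theta
series `thetaDdot` of [EtTh] Prop. 1.4 (`ClassicalTheta.lean`, abc-iut-L2-t1). The bibliographic key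
`MochizukiEtAl2022` carries the D-0012 claim status (the paper's §5 depends on [IUTchIII] Cor. 3.12), hence
the tag form; nothing in this file bears on that dispute.

**Lemma 3.1 as printed (p. 198).** "Let `n ≥ 2` be an even integer; `k` an algebraically closed field of
characteristic zero. Write `μ^×_{2n} ⊆ k^×` for the set of primitive `2n`-th roots of unity in `k`;
`Aut(μ^×_{2n})` for the group of automorphisms of the set `μ^×_{2n}`; `G₋ ⊆ Aut(μ^×_{2n})` (respectively,
`G⁻ ⊆ Aut(μ^×_{2n})`) for the subgroup of cardinality two generated by the automorphism of `μ^×_{2n}`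
defined as follows: `∀ ζ ∈ μ^×_{2n}`, `ζ ↦ −ζ` (respectively, `ζ ↦ ζ⁻¹`). [Note that since `n` is even, it
follows that `−ζ ∈ μ^×_{2n}`.] Then the following conditions are equivalent: (1) `n ∈ {2, 4, 6}`. (2) The
action of `G₋ × G⁻` on `μ^×_{2n}` is transitive."

*Rendering.* The `G₋ × G⁻`-orbit of `ζ` is the set `{ζ, −ζ, ζ⁻¹, −ζ⁻¹}`, so condition (2) reads: for all
primitive `2n`-th roots of unity `ζ, ζ'` one has `ζ' ∈ {ζ, −ζ, ζ⁻¹, −ζ⁻¹}` — typed as that disjunction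
(no group-action structure is introduced). `ExpEst.lemma31` is the printed equivalence; it is assembled from
two sharper halves proved over ANY field: (1) ⇒ (2) with no hypothesis on `k`
(`orbit_of_mem_two_four_six`), and (2) ⇒ (1) as soon as `k` contains one primitive `2n`-th root of unity
(`mem_two_four_six_of_orbit`) — algebraic closedness and characteristic zero are used exactly to provide
that root (`exists_isPrimitiveRoot_of_isAlgClosed`, via the cyclotomic polynomial).
*Printed proof.* "(1) ⇒ (2) is immediate from the definitions … the transitivity of the action of the
group `G₋ × G⁻` [whose cardinality is four] on `μ^×_{2n}` implies that `#(μ^×_{2n}) ≤ 4` … one verifies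
easily that `n ∈ {1, 2, 3, 4, 5, 6}`. Since `n` is even, we thus conclude that `n ∈ {2, 4, 6}`." The kernel
proof of (2) ⇒ (1) replaces the count `#μ^×_{2n} = φ(2n) ≤ 4` by two explicit witnesses: with `n = 2m`,
the exponent `m + 1` (for `m` even) resp. `m + 2` (for `m` odd) is prime to `2n`, and `ζ^{m+1}` resp.
`ζ^{m+2}` lies in the orbit `{ζ, ζ^{n+1}, ζ^{2n−1}, ζ^{n−1}}` only if `n ∈ {2, 4, 6}`.

**Proposition 3.2 as printed (pp. 198–199).** "In the notation of [EtTh], Proposition 1.4: Suppose that `K̈`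
contains a primitive 12-th root of unity `ζ₁₂`. Thus, we note that the set of primitive 12-th roots of unity
in `K̈` coincides with the set `{ζ₁₂, ζ₁₂⁵, ζ₁₂⁷, ζ₁₂¹¹}`. Recall the theta function
`Θ̈(Ü) = q^{−1/8} Σ_{n ∈ ℤ} (−1)^n q^{(1/2)(n+1/2)²} Ü^{2n+1}`, which satisfies the relations
`Θ̈(Ü) = −Θ̈(Ü⁻¹) = −Θ̈(−Ü)` [cf. [EtTh], Proposition 1.4, (ii)]. Then the following hold:
(i) We have `Θ̈(ζ₁₂), Θ̈(ζ₁₂⁵), Θ̈(ζ₁₂⁷), Θ̈(ζ₁₂¹¹) ∈ {Θ̈(ζ₁₂), −Θ̈(ζ₁₂)}`. (ii) We have `Θ̈(ζ₁₂) ∈ O^×_{K̈}`.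
Proof. Assertion (i) follows immediately from Lemma 3.1 and [EtTh], Proposition 1.4, (ii). Assertion (ii)
follows immediately from the fact that `ζ₁₂ − ζ₁₂⁻¹ ∈ O^×_{K̈}` [cf. the equality `−(ζ₁₂ − ζ₁₂⁻¹)² = 1`]."

*Rendering.* `Θ̈` is the tree's `thetaDdot q̈` (over any normed field; `q̈ = q^{1/2}`), whose relations
(ii) are the tree's `thetaDdot_inv`, `thetaDdot_neg`. (i) is `ExpEst.prop32_i` (with the signs made
explicit: `Θ̈(ζ⁵) = Θ̈(ζ)`, `Θ̈(ζ⁷) = Θ̈(ζ¹¹) = −Θ̈(ζ)`) and, in the orbit form of Lemma 3.1,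
`ExpEst.prop32_i'` (every primitive 12-th root `ζ'` has `Θ̈(ζ') = ±Θ̈(ζ)`). (ii) "`Θ̈(ζ₁₂) ∈ O^×_{K̈}`" is
rendered `‖Θ̈(ζ₁₂)‖ = 1` over a complete ultrametric normed field with `‖q̈‖ < 1` ([EtTh]: `K̈` a finite
extension of `ℚ_p`, `q̈` a square root of the `q`-parameter) — `ExpEst.prop32_ii`, proved exactly as
printed: `(ζ₁₂ − ζ₁₂⁻¹)² = −1` (`sq_sub_inv_of_isPrimitiveRoot_twelve`), so `‖ζ₁₂ − ζ₁₂⁻¹‖ = 1`, and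
`‖Θ̈(Ü)‖ = ‖Ü − Ü⁻¹‖` on the unit circle (the tree's `norm_thetaDdot_of_norm_eq_one`,
`ClassicalThetaSpecialFibre.lean`). For contrast the tree already records `‖Θ̈(√−1)‖ = ‖2‖`
(`ClassicalThetaRawValue.lean`): the original normalisation point fails to give a unit exactly over `2`,
which is the point of the paper's passage from `2`-torsion to `6`-torsion translates (Introduction p. 181).

Deliberately NOT here: Def. 3.3–3.5 ("μ₆-standard" sets of values / type, orbicurves of type
`(1, μ₂ × ℤ/lℤ)`), Rmk. 3.3.1–3.5.3 and §4 (patch lists for [EtTh], [IUTchI–III]) — class-level statements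
over the tempered interface, owned by layer L2/L5 seats. No definition and no named fact is introduced.

## References
* [MochizukiEtAl2022] Kodai Math. J. 45 (2022), Lemma 3.1, Prop. 3.2, Rmk. 3.2.1 (pp. 198–199).
* [MochizukiEtTh2009] S. Mochizuki, Publ. RIMS 45 (2009), Prop. 1.4 (the series `Θ̈` and its relations).
-/

noncomputable section

namespace Literature.AnabelianGeometry.EtaleTheta

namespace ExpEst

/-! ### Roots of unity: elementary facts used by both items -/

section Field

variable {k : Type*} [Field k]

/-- For a primitive `2n`-th root of unity `ζ` (`n ≥ 1`): `ζ^n = −1`. [folklore] -/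
private theorem pow_half_eq_neg_one {ζ : k} {n : ℕ} (hn : 0 < n) (hζ : IsPrimitiveRoot ζ (2 * n)) :
    ζ ^ n = -1 := by
  have h2 : IsPrimitiveRoot (ζ ^ n) 2 := hζ.pow (by omega) (by ring)
  exact h2.eq_neg_one_of_two_right

/-- The orbit `{ζ, −ζ, ζ⁻¹, −ζ⁻¹}` of a primitive `2n`-th root `ζ` in exponent form:
`−ζ = ζ^{n+1}`, `ζ⁻¹ = ζ^{2n−1}`, `−ζ⁻¹ = ζ^{n−1}` (`n ≥ 1`). [folklore] -/
private theorem orbit_eq_pow {ζ : k} {n : ℕ} (hn : 0 < n) (hζ : IsPrimitiveRoot ζ (2 * n)) :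
    -ζ = ζ ^ (n + 1) ∧ ζ⁻¹ = ζ ^ (2 * n - 1) ∧ -ζ⁻¹ = ζ ^ (n - 1) := by
  have hζ0 : ζ ≠ 0 := hζ.ne_zero (by omega)
  have hn1 := pow_half_eq_neg_one hn hζ
  have hone : ζ ^ (2 * n) = 1 := hζ.pow_eq_one
  refine ⟨?_, ?_, ?_⟩
  · rw [pow_succ, hn1]; ring
  · have h : ζ ^ (2 * n - 1) * ζ = 1 := by
      rw [← pow_succ, Nat.sub_add_cancel (by omega), hone]
    exact (eq_inv_of_mul_eq_one_left h).symm
  · have h : ζ ^ (n - 1) * ζ = -1 := by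
      rw [← pow_succ, Nat.sub_add_cancel (by omega), hn1]
    have h' : ζ ^ (n - 1) = -1 * ζ⁻¹ := by
      rw [eq_mul_inv_iff_mul_eq₀ hζ0, h]
    rw [h']; ring

/-- Every primitive `N`-th root of unity is a power `ζ^i`, `i < N`, `i` prime to `N`, of a given one.
[folklore] -/
private theorem exists_pow_eq_of_isPrimitiveRoot {ζ ζ' : k} {N : ℕ} (hN : 0 < N) (hζ : IsPrimitiveRoot ζ N)
    (hζ' : IsPrimitiveRoot ζ' N) : ∃ i : ℕ, i < N ∧ i.Coprime N ∧ ζ ^ i = ζ' := by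
  haveI : NeZero N := ⟨hN.ne'⟩
  obtain ⟨i, hi, rfl⟩ := hζ.eq_pow_of_pow_eq_one hζ'.pow_eq_one
  exact ⟨i, hi, (hζ.pow_iff_coprime hN i).mp hζ', rfl⟩

/-- An algebraically closed field of characteristic zero contains a primitive `N`-th root of unity for
every `N ≥ 1` (a root of the `N`-th cyclotomic polynomial). [folklore] -/
private theorem exists_isPrimitiveRoot_of_isAlgClosed (k : Type*) [Field k] [IsAlgClosed k] [CharZero k]
    {N : ℕ} (hN : 0 < N) : ∃ ζ : k, IsPrimitiveRoot ζ N := by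
  haveI : NeZero (N : k) := ⟨by exact_mod_cast hN.ne'⟩
  obtain ⟨ζ, hζ⟩ := IsAlgClosed.exists_root (Polynomial.cyclotomic N k)
    (Polynomial.degree_cyclotomic_pos N k hN).ne'
  exact ⟨ζ, (Polynomial.isRoot_cyclotomic_iff).mp hζ⟩

/-! ### Lemma 3.1 -/

/-- **[ExpEst] Lemma 3.1, (1) ⇒ (2)** (p. 198), over any field: if `n ∈ {2, 4, 6}`, then any two primitive
`2n`-th roots of unity `ζ, ζ'` satisfy `ζ' ∈ {ζ, −ζ, ζ⁻¹, −ζ⁻¹}` (the `G₋ × G⁻`-orbit of `ζ`). PROVED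
("immediate from the definitions": `ζ' = ζ^i` with `i` prime to `2n`, and `ζ^n = −1`).
[claim: MochizukiEtAl2022, status: disputed] -/
theorem orbit_of_mem_two_four_six {n : ℕ} (hn : n ∈ ({2, 4, 6} : Finset ℕ)) {ζ ζ' : k}
    (hζ : IsPrimitiveRoot ζ (2 * n)) (hζ' : IsPrimitiveRoot ζ' (2 * n)) :
    ζ' = ζ ∨ ζ' = -ζ ∨ ζ' = ζ⁻¹ ∨ ζ' = -ζ⁻¹ := by
  simp only [Finset.mem_insert, Finset.mem_singleton] at hn
  have hn0 : 0 < n := by omega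
  obtain ⟨h1, h2, h3⟩ := orbit_eq_pow hn0 hζ
  obtain ⟨i, hi, hcop, rfl⟩ := exists_pow_eq_of_isPrimitiveRoot (by omega) hζ hζ'
  rw [h3, h1, h2]
  clear h1 h2 h3 hζ'
  rcases hn with rfl | rfl | rfl
  · -- `2n = 4`, `i ∈ {1, 3}`
    interval_cases i <;> first | exact absurd hcop (by decide) | simp
  · -- `2n = 8`, `i ∈ {1, 3, 5, 7}`
    interval_cases i <;> first | exact absurd hcop (by decide) | simp
  · -- `2n = 12`, `i ∈ {1, 5, 7, 11}`
    interval_cases i <;> first | exact absurd hcop (by decide) | simp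

/-- **[ExpEst] Lemma 3.1, (2) ⇒ (1)** (p. 198), over any field CONTAINING a primitive `2n`-th root of unity
`ζ` (`n ≥ 2` even): if every primitive `2n`-th root of unity lies in `{ζ, −ζ, ζ⁻¹, −ζ⁻¹}`, then
`n ∈ {2, 4, 6}`. PROVED (witness exponents `n/2 + 1`, `n/2 + 2`; see the module docstring).
[claim: MochizukiEtAl2022, status: disputed] -/
theorem mem_two_four_six_of_orbit {n : ℕ} (hn : 2 ≤ n) (he : Even n) {ζ : k}
    (hζ : IsPrimitiveRoot ζ (2 * n))
    (h : ∀ ζ' : k, IsPrimitiveRoot ζ' (2 * n) → ζ' = ζ ∨ ζ' = -ζ ∨ ζ' = ζ⁻¹ ∨ ζ' = -ζ⁻¹) :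
    n ∈ ({2, 4, 6} : Finset ℕ) := by
  simp only [Finset.mem_insert, Finset.mem_singleton]
  obtain ⟨m, rfl⟩ := he
  have hm : 1 ≤ m := by omega
  obtain ⟨h1, h2, h3⟩ := orbit_eq_pow (by omega : 0 < m + m) hζ
  -- the witness exponent `j`, prime to `2n = 4m`
  obtain ⟨j, hjdef⟩ : ∃ j : ℕ, j = if Even m then m + 1 else m + 2 := ⟨_, rfl⟩
  have hjcop : j.Coprime (2 * (m + m)) := by
    have e : 2 * (m + m) = m * 4 := by ring
    rw [e, Nat.coprime_mul_iff_right]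
    rcases Nat.even_or_odd m with hme | hmo
    · rw [if_pos hme] at hjdef
      subst hjdef
      refine ⟨Nat.coprime_self_add_left.mpr (Nat.coprime_one_left m), ?_⟩
      have h4 : (4 : ℕ) = 2 ^ 2 := by norm_num
      rw [h4]
      refine Nat.Coprime.pow_right 2 ?_
      rw [Nat.coprime_comm, Nat.Prime.coprime_iff_not_dvd Nat.prime_two]
      obtain ⟨t, rfl⟩ := hme; omega
    · have hmo' : ¬ Even m := Nat.not_even_iff_odd.mpr hmo
      rw [if_neg hmo'] at hjdef
      subst hjdef
      obtain ⟨t, rfl⟩ := hmo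
      refine ⟨?_, ?_⟩
      · -- `gcd(m + 2, m) = gcd(2, m) = 1` for `m` odd
        rw [Nat.coprime_self_add_left, Nat.Prime.coprime_iff_not_dvd Nat.prime_two]
        omega
      · have h4 : (4 : ℕ) = 2 ^ 2 := by norm_num
        rw [h4]
        refine Nat.Coprime.pow_right 2 ?_
        rw [Nat.coprime_comm, Nat.Prime.coprime_iff_not_dvd Nat.prime_two]
        omega
  have hjlt : j < 2 * (m + m) := by split_ifs at hjdef <;> omega
  have hζj : IsPrimitiveRoot (ζ ^ j) (2 * (m + m)) := (hζ.pow_iff_coprime (by omega) j).mpr hjcop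
  have hcases := h (ζ ^ j) hζj
  rw [h3, h1, h2] at hcases
  -- compare exponents: all are `< 2n`
  have hinj : ∀ {a b : ℕ}, a < 2 * (m + m) → b < 2 * (m + m) → ζ ^ a = ζ ^ b → a = b :=
    fun ha hb hab => hζ.pow_inj ha hb hab
  rcases hcases with hc | hc | hc | hc
  · have := hinj hjlt (by omega) (hc.trans (pow_one ζ).symm)
    split_ifs at hjdef <;> omega
  · have := hinj hjlt (by omega) hc
    split_ifs at hjdef <;> omega
  · have := hinj hjlt (by omega) hc
    split_ifs at hjdef <;> omega
  · have := hinj hjlt (by omega) hc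
    split_ifs at hjdef <;> omega

end Field

/-- **[ExpEst] Lemma 3.1** (p. 198), as printed: for `n ≥ 2` even and `k` an algebraically closed field of
characteristic zero, `n ∈ {2, 4, 6}` if and only if the action of `G₋ × G⁻` (`ζ ↦ −ζ`, `ζ ↦ ζ⁻¹`) on the
set `μ^×_{2n}(k)` of primitive `2n`-th roots of unity is transitive, i.e. iff any two primitive `2n`-th roots
`ζ, ζ'` satisfy `ζ' ∈ {ζ, −ζ, ζ⁻¹, −ζ⁻¹}`. PROVED. [claim: MochizukiEtAl2022, status: disputed] -/
theorem lemma31 (k : Type*) [Field k] [IsAlgClosed k] [CharZero k] {n : ℕ} (hn : 2 ≤ n) (he : Even n) :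
    n ∈ ({2, 4, 6} : Finset ℕ) ↔
      ∀ ζ ζ' : k, IsPrimitiveRoot ζ (2 * n) → IsPrimitiveRoot ζ' (2 * n) →
        (ζ' = ζ ∨ ζ' = -ζ ∨ ζ' = ζ⁻¹ ∨ ζ' = -ζ⁻¹) := by
  constructor
  · intro h ζ ζ' hζ hζ'
    exact orbit_of_mem_two_four_six h hζ hζ'
  · intro h
    obtain ⟨ζ, hζ⟩ := exists_isPrimitiveRoot_of_isAlgClosed k (N := 2 * n) (by omega)
    exact mem_two_four_six_of_orbit hn he hζ (fun ζ' hζ' => h ζ ζ' hζ hζ')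

/-! ### Proposition 3.2 -/

section Theta

variable {𝕜 : Type*} [NormedField 𝕜]

/-- The four primitive 12-th roots of unity are `ζ, ζ⁵, ζ⁷, ζ¹¹` ("the set of primitive 12-th roots of unity
in `K̈` coincides with `{ζ₁₂, ζ₁₂⁵, ζ₁₂⁷, ζ₁₂¹¹}`", p. 198–199), over any field. PROVED.
[claim: MochizukiEtAl2022, status: disputed] -/
theorem eq_pow_of_isPrimitiveRoot_twelve {k : Type*} [Field k] {ζ ζ' : k} (hζ : IsPrimitiveRoot ζ 12)
    (hζ' : IsPrimitiveRoot ζ' 12) : ζ' = ζ ∨ ζ' = ζ ^ 5 ∨ ζ' = ζ ^ 7 ∨ ζ' = ζ ^ 11 := by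
  obtain ⟨i, hi, hcop, rfl⟩ := exists_pow_eq_of_isPrimitiveRoot (by norm_num) hζ hζ'
  clear hζ'
  interval_cases i <;> first | exact absurd hcop (by decide) | simp

/-- For a primitive 12-th root of unity `ζ`: `ζ⁵ = −ζ⁻¹`, `ζ⁷ = −ζ`, `ζ¹¹ = ζ⁻¹` (`ζ⁶ = −1`). [folklore] -/
private theorem pow_five_seven_eleven_of_isPrimitiveRoot_twelve {k : Type*} [Field k] {ζ : k}
    (hζ : IsPrimitiveRoot ζ 12) : ζ ^ 5 = -ζ⁻¹ ∧ ζ ^ 7 = -ζ ∧ ζ ^ 11 = ζ⁻¹ := by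
  obtain ⟨h1, h2, h3⟩ := orbit_eq_pow (by norm_num : 0 < 6) (show IsPrimitiveRoot ζ (2 * 6) from hζ)
  exact ⟨h3.symm, h1.symm, h2.symm⟩

/-- **[ExpEst] Proposition 3.2 (i)** (p. 199), with the signs made explicit: for the theta series `Θ̈ = thetaDdot q̈`
of [EtTh] Prop. 1.4 over any normed field and a primitive 12-th root of unity `ζ`,
`Θ̈(ζ⁵) = Θ̈(ζ)`, `Θ̈(ζ⁷) = −Θ̈(ζ)`, `Θ̈(ζ¹¹) = −Θ̈(ζ)`; in particular all four values `Θ̈(ζ), Θ̈(ζ⁵), Θ̈(ζ⁷),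
Θ̈(ζ¹¹)` lie in `{Θ̈(ζ), −Θ̈(ζ)}`. PROVED from the relations `Θ̈(Ü) = −Θ̈(Ü⁻¹) = −Θ̈(−Ü)` (the tree's
`thetaDdot_inv`, `thetaDdot_neg` = [EtTh] Prop. 1.4 (ii)), as in the printed proof.
[claim: MochizukiEtAl2022, status: disputed] -/
theorem prop32_i (q2 : 𝕜) {ζ : 𝕜} (hζ : IsPrimitiveRoot ζ 12) :
    thetaDdot q2 (ζ ^ 5) = thetaDdot q2 ζ ∧ thetaDdot q2 (ζ ^ 7) = -thetaDdot q2 ζ ∧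
      thetaDdot q2 (ζ ^ 11) = -thetaDdot q2 ζ := by
  obtain ⟨h5, h7, h11⟩ := pow_five_seven_eleven_of_isPrimitiveRoot_twelve hζ
  refine ⟨?_, ?_, ?_⟩
  · rw [h5, thetaDdot_neg, thetaDdot_inv, neg_neg]
  · rw [h7, thetaDdot_neg]
  · rw [h11, thetaDdot_inv]

/-- **[ExpEst] Proposition 3.2 (i)**, orbit form (p. 199): every primitive 12-th root of unity `ζ'` has
`Θ̈(ζ') ∈ {Θ̈(ζ), −Θ̈(ζ)}`. PROVED (Lemma 3.1 with `n = 6`, and the relations of [EtTh] Prop. 1.4 (ii)).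
[claim: MochizukiEtAl2022, status: disputed] -/
theorem prop32_i' (q2 : 𝕜) {ζ ζ' : 𝕜} (hζ : IsPrimitiveRoot ζ 12) (hζ' : IsPrimitiveRoot ζ' 12) :
    thetaDdot q2 ζ' = thetaDdot q2 ζ ∨ thetaDdot q2 ζ' = -thetaDdot q2 ζ := by
  obtain ⟨h5, h7, h11⟩ := prop32_i q2 hζ
  rcases eq_pow_of_isPrimitiveRoot_twelve hζ hζ' with rfl | rfl | rfl | rfl
  · exact Or.inl rfl
  · exact Or.inl h5
  · exact Or.inr h7
  · exact Or.inr h11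

/-- "`−(ζ₁₂ − ζ₁₂⁻¹)² = 1`" (p. 199, proof of Prop. 3.2 (ii)): for a primitive 12-th root of unity `ζ` in a
field, `(ζ − ζ⁻¹)² = −1` (indeed `ζ²` is a primitive 6-th root `η`, `η² − η + 1 = 0`, so
`ζ² + ζ⁻² = η + η⁻¹ = 1`). PROVED. [claim: MochizukiEtAl2022, status: disputed] -/
theorem sq_sub_inv_of_isPrimitiveRoot_twelve {k : Type*} [Field k] {ζ : k} (hζ : IsPrimitiveRoot ζ 12) :
    (ζ - ζ⁻¹) ^ 2 = -1 := by
  have hζ0 : ζ ≠ 0 := hζ.ne_zero (by norm_num)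
  have h6 : ζ ^ 6 = -1 := pow_half_eq_neg_one (by norm_num) (show IsPrimitiveRoot ζ (2 * 6) from hζ)
  have h4 : ζ ^ 4 ≠ 1 := hζ.pow_ne_one_of_pos_of_lt (by norm_num) (by norm_num)
  -- `η = ζ²`: `η³ = −1`, `η ≠ −1`, hence `η² − η + 1 = 0`
  have hcub : (ζ ^ 2 + 1) * ((ζ ^ 2) ^ 2 - ζ ^ 2 + 1) = 0 := by
    have : (ζ ^ 2) ^ 3 = -1 := by
      calc (ζ ^ 2) ^ 3 = ζ ^ 6 := by ring
        _ = -1 := h6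
    linear_combination this
  have hne : ζ ^ 2 + 1 ≠ 0 := by
    intro h0
    apply h4
    have : ζ ^ 2 = -1 := by linear_combination h0
    calc ζ ^ 4 = (ζ ^ 2) ^ 2 := by ring
      _ = 1 := by rw [this]; ring
  have hrel : (ζ ^ 2) ^ 2 - ζ ^ 2 + 1 = 0 := (mul_eq_zero.mp hcub).resolve_left hne
  -- `(ζ − ζ⁻¹)² · ζ² = ζ⁴ − 2ζ² + 1 = −ζ²`
  have key : (ζ - ζ⁻¹) ^ 2 * ζ ^ 2 = -1 * ζ ^ 2 := by
    have e : (ζ - ζ⁻¹) ^ 2 * ζ ^ 2 = (ζ ^ 2) ^ 2 - 2 * ζ ^ 2 + 1 := by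
      field_simp
      ring
    rw [e]; linear_combination hrel
  exact mul_right_cancel₀ (pow_ne_zero 2 hζ0) key

/-- A root of unity has absolute value `1` in any normed field. [folklore] -/
private theorem norm_eq_one_of_isPrimitiveRoot {ζ : 𝕜} {N : ℕ} (hN : 0 < N) (hζ : IsPrimitiveRoot ζ N) :
    ‖ζ‖ = 1 := by
  have h : ‖ζ‖ ^ N = 1 := by rw [← norm_pow, hζ.pow_eq_one, norm_one]
  exact (pow_eq_one_iff_of_nonneg (norm_nonneg ζ) hN.ne').mp h

/-- "`ζ₁₂ − ζ₁₂⁻¹ ∈ O^×_{K̈}`" (p. 199): `‖ζ − ζ⁻¹‖ = 1` for a primitive 12-th root of unity `ζ` in a normed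
field (from `(ζ − ζ⁻¹)² = −1`). PROVED. [claim: MochizukiEtAl2022, status: disputed] -/
theorem norm_sub_inv_of_isPrimitiveRoot_twelve {ζ : 𝕜} (hζ : IsPrimitiveRoot ζ 12) : ‖ζ - ζ⁻¹‖ = 1 := by
  have h : ‖ζ - ζ⁻¹‖ ^ 2 = 1 := by
    rw [← norm_pow, sq_sub_inv_of_isPrimitiveRoot_twelve hζ, norm_neg, norm_one]
  exact (pow_eq_one_iff_of_nonneg (norm_nonneg _) two_ne_zero).mp h

/-- **[ExpEst] Proposition 3.2 (ii)** (p. 199): "`Θ̈(ζ₁₂) ∈ O^×_{K̈}`" — for the theta series `Θ̈ = thetaDdot q̈`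
of [EtTh] Prop. 1.4 over a complete nonarchimedean (ultrametric) normed field with `‖q̈‖ < 1` and a primitive
12-th root of unity `ζ`, the value `Θ̈(ζ)` is a UNIT of the valuation ring: `‖Θ̈(ζ)‖ = 1`. PROVED as printed:
`‖Θ̈(Ü)‖ = ‖Ü − Ü⁻¹‖` on the unit circle (the tree's `norm_thetaDdot_of_norm_eq_one`, [EtTh] Prop. 1.4 (i),
proof: "the restriction of `Θ̈` to the component labelled `0` is `Ü − Ü⁻¹`") and `‖ζ − ζ⁻¹‖ = 1`. (Contrast:
`‖Θ̈(√−1)‖ = ‖2‖`, `ClassicalThetaRawValue.norm_thetaDdot_sqrt_neg_one` — not a unit over `2`.)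
[claim: MochizukiEtAl2022, status: disputed] -/
theorem prop32_ii [IsUltrametricDist 𝕜] [CompleteSpace 𝕜] {q2 ζ : 𝕜} (hq : ‖q2‖ < 1)
    (hζ : IsPrimitiveRoot ζ 12) : ‖thetaDdot q2 ζ‖ = 1 := by
  rw [norm_thetaDdot_of_norm_eq_one hq (norm_eq_one_of_isPrimitiveRoot (by norm_num) hζ),
    norm_sub_inv_of_isPrimitiveRoot_twelve hζ]

end Theta

end ExpEst

end Literature.AnabelianGeometry.EtaleTheta

end
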